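import Summits.AtomisticToContinuum.HydrodynamicLimit.Theses.JParityClosure
import Literature.MathematicalPhysics.KineticTheory.LinearizedEnskogOperator
import Summits.AtomisticToContinuum.HydrodynamicLimit.Theorems.EvenStressEnskog.Negative.PairFunctionalVanishing

/-!
# Sketch — crux `EvenStressEnskog` (stmt-AtomisticToContinuum-13079), round 1, ideator 2

First-lemma signatures (and the cheap proofs) for the two crux idea cards of this seat:

* **Card B `closure-invariance-principle`** — `EvenStressWith Y η₀` (the crux with the contact-value
  function `Y` and the threshold `η₀` exposed), `evenStressEnskog_iff` (the crux IS `∃ η₀, EvenStressWith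
  thermoContact η₀`), the universality statement `UniversalEvenContactLaw` (U), the PINNING lemma
  `evenStressWith_congr_below` (proved: the crux is cutoff-local in `Y`, so a universal law that agrees with
  `thermoContact` below some `η₁` gives the crux with threshold `min η₀ η₁`), its positive-arguments
  variant `evenStressWith_congr_pos` (PROVED with the disprover's landed §4 lemma
  `pairFunctional_eq_zero_of_mollifiedDensity_eq_zero`: the junk branch `a ≤ 0` is killed by `ρ_r ≥ 0` and
  `ρ_r = 0 ⇒ B_r = 0`), the rung-0 static input `CanonicalContactConvergence`, and the assembly
  `evenStressEnskog_of_universal` (proved from the two congruence lemmas).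
* **Card A `defect-hierarchy-zero-driving`** — `localMaxwellian_collide_mul` (Maxwellian pair weights are
  collision invariants, proved), `defect_level2_integrand` + `defect_level2_collision_term` (proved: in the
  defect hierarchy the (1,3)-collision terms of `δu₂(1,2)·M(3) + δu₂(3,2)·M(1)` are EXACTLY
  `M(v₁)·𝓛♭[g](v₁)` with the tree's `linearizedEnskogOperator`, coefficient `ρM` only — the
  state-independent linear part), `spectator_source_vanishes` (proved: one-body stationarity in weak form
  kills every spectator-factorised source), and the first genuine stub signature `PairLiouville`.

Nothing here is filed as an item; this file only has to elaborate — `lean check` rc 0, 0 sorries, axioms of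
`evenStressEnskog_of_universal` = propext / Classical.choice / Quot.sound.
-/

open MeasureTheory Metric Real Filter Set Topology
open scoped InnerProductSpace BigOperators ENNReal

namespace Summit.AtomisticToContinuum.HydrodynamicLimit.Cruxes.EvenStressEnskog.IdeatorTwo

open Literature.MathematicalPhysics.KineticTheory Literature.Analysis.FluidPDE
open Summit.AtomisticToContinuum.HydrodynamicLimit.Theses.JParityClosure

noncomputable section

/-! ## Card B — closure-invariance-principle -/

/-- The crux `EvenStressEnskog` with the contact-value function `Y : ℝ → ℝ` and the density threshold
`η₀` exposed as parameters (body copied verbatim from the route decl, `let Y := …` removed). -/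
def EvenStressWith (Y : ℝ → ℝ) (η₀ : ℝ) : Prop :=
  ∀ (a₀ θ₀ : Literature.MathematicalPhysics.KineticTheory.T3 → ℝ) (u₀ : Literature.MathematicalPhysics.KineticTheory.T3 → Literature.MathematicalPhysics.KineticTheory.V3), Continuous a₀ → Continuous θ₀ → Continuous u₀ → (∀ x, 0 < a₀ x) → (∀ x, 0 < θ₀ x) → ∃ σ₀ : ℝ, 0 < σ₀ ∧ ∀ σ : ℝ, 0 < σ → σ < σ₀ → ∀ Φ : (N : ℕ) → Literature.Analysis.FluidPDE.HardSphereFlow (Literature.Analysis.FluidPDE.Torus.geometry (Fin 3)) (Literature.MathematicalPhysics.KineticTheory.hsDiameter σ N) (N + 1), ∀ τ : ℝ, 0 < τ → ∀ χ : ℝ × UnitAddTorus (Fin 3) → ℝ, Continuous χ → ∀ g : ℝ → ℝ, Continuous g → (∀ a, η₀ ≤ a → g a = 0) → ∀ η δ : ℝ, 0 < η → 0 < δ → ∃ r₀ : ℝ, 0 < r₀ ∧ ∀ r : ℝ, 0 < r → r < r₀ → ∃ N₀ : ℕ, ∀ N : ℕ, N₀ ≤ N → let ε := Literature.MathematicalPhysics.KineticTheory.hsDiameter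 σ N; let G := Literature.Analysis.FluidPDE.Torus.geometry (Fin 3); let γ := fun z (s : ℝ) => (Φ N).flow s z; let bx : UnitAddTorus (Fin 3) → UnitAddTorus (Fin 3) → ℝ := fun x y => 3 / (Real.pi * r ^ 3) * max (1 - Literature.Analysis.FluidPDE.Torus.euclidDist x y / r) 0; let ρm := fun z s (x₀ : UnitAddTorus (Fin 3)) => ∫ q, bx q.1 x₀ ∂(Literature.Analysis.FluidPDE.empiricalMeasure (γ z s)); let Θ := fun (Ξ : EuclideanSpace ℝ (Fin 3) × EuclideanSpace ℝ (Fin 3) × EuclideanSpace ℝ (Fin 3) → ℝ) (v w : EuclideanSpace ℝ (Fin 3)) => ∫ ω : Metric.sphere (0 : EuclideanSpace ℝ (Fin 3)) 1, Ξ ((ω : EuclideanSpace ℝ (Fin 3)), v, w) * Literature.MathematicalPhysics.KineticTheory.hardSphereKernel (w, v) ω ∂Literature.MathematicalPhysics.KineticTheory.sphereMeasure; let B := fun Ξ z s (x₀ : UnitAddTorus (Fin 3)) => ∫ p, bx p.1.1 x₀ * bx p.2.1 x₀ * Θ Ξ p.1.2 p.2.2 ∂((Literature.Analysis.FluidPDE.empiricalMeasure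 (γ z s)).prod (Literature.Analysis.FluidPDE.empiricalMeasure (γ z s))); let pv := fun z s (i j : Fin (N + 1)) => Literature.Analysis.FluidPDE.reflectVel (G.sepVec (γ z s i).1 (γ z s j).1) ((γ z s i).2, (γ z s j).2); let Kc := fun (Fn : Literature.Analysis.FluidPDE.Config (N + 1) (Fin 3) Literature.MathematicalPhysics.KineticTheory.T3 → ℝ → Fin (N + 1) → Fin (N + 1) → ℝ) z => ε / (N + 1 : ℝ) * ∑ᶠ (s : ℝ) (_ : s ∈ Literature.Analysis.FluidPDE.collisionTimes G ε (γ z) ∩ Set.Icc 0 τ), ∑ i : Fin (N + 1), ∑ j : Fin (N + 1), (if i ≠ j ∧ ‖G.sepVec (γ z s i).1 (γ z s j).1‖ = ε then Fn z s i j else 0); let Dm := fun (Ξ : EuclideanSpace ℝ (Fin 3) × EuclideanSpace ℝ (Fin 3) × EuclideanSpace ℝ (Fin 3) → ℝ) z => Kc (fun z s i j => χ (s, (γ z s i).1) * g (σ ^ 3 * ρm z s (γ z s i).1) * Ξ (ε⁻¹ • G.sepVec (γ z s i).1 (γ z s j).1, (pv z s i j).1, (pv z s i j).2)) z - σ ^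 3 * ∫ s in Set.Icc (0 : ℝ) τ, ∫ x : UnitAddTorus (Fin 3), χ (s, x) * g (σ ^ 3 * ρm z s x) * Y (σ ^ 3 * ρm z s x) * B Ξ z s x; let ΞP := fun (k l : Fin 3) (q : EuclideanSpace ℝ (Fin 3) × EuclideanSpace ℝ (Fin 3) × EuclideanSpace ℝ (Fin 3)) => max ⟪q.2.2 - q.2.1, q.1⟫_ℝ 0 * (q.1 k * q.1 l); ∀ k l : Fin 3, Literature.MathematicalPhysics.KineticTheory.localGibbsLaw σ a₀ u₀ θ₀ N (Φ N) {z | η < |Dm (ΞP k l) z|} ≤ ENNReal.ofReal δ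

/-- The thermodynamic contact value `Y(η) = (3/2π)·f_ex′(η)` of the route decl. -/
def thermoContact : ℝ → ℝ := fun a => 3 / (2 * Real.pi) * deriv hsExcessFreeEnergy a

/-- The crux is literally `∃ η₀ > 0, EvenStressWith thermoContact η₀`. -/
theorem evenStressEnskog_iff :
    EvenStressEnskog ↔ ∃ η₀ : ℝ, 0 < η₀ ∧ EvenStressWith thermoContact η₀ := Iff.rfl

/-- **(U) closure universality.** The J-even momentum-transfer statistics take the Enskog FORM with SOME
universal contact law `Yu` of the local reduced density, continuous on the OPEN band `(0, η₀)` (the disprover's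
§3/§5: the crux's own `Y` is not right-continuous at `0`, so nothing is asked at `0`): existence of an Euler-scale
equation of state for the contact statistics, value unknown. Card B: (U) ∧ (rung 0) ⇒ crux, and conversely the
crux gives (U) with `Yu := thermoContact` (continuous on `(0, η₀)` by HsEosLowDensity). -/
def UniversalEvenContactLaw : Prop :=
  ∃ η₀ : ℝ, 0 < η₀ ∧ ∃ Yu : ℝ → ℝ, ContinuousOn Yu (Ioo 0 η₀) ∧ EvenStressWith Yu η₀

/-- **Pinning lemma (multiplicative core, proved).** `EvenStressWith` depends on `Y` only through the
products `g a · Y a` with the cutoff `g` vanishing on `[η₀, ∞)`; hence a law `Yu` that agrees with `Y`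
below `η₁` transfers the statement to `Y` with threshold `min η₀ η₁`. -/
theorem evenStressWith_congr_below {Yu Y : ℝ → ℝ} {η₀ η₁ : ℝ} (hU : EvenStressWith Yu η₀)
    (heq : ∀ a, a < η₁ → Yu a = Y a) : EvenStressWith Y (min η₀ η₁) := by
  intro a₀ θ₀ u₀ ha hθ hu ha0 hθ0
  obtain ⟨σ₀, hσ₀, H⟩ := hU a₀ θ₀ u₀ ha hθ hu ha0 hθ0
  refine ⟨σ₀, hσ₀, ?_⟩
  intro σ hσ hσ' Φ τ hτ χ hχ g hg hcut
  have hcut' : ∀ a, η₀ ≤ a → g a = 0 := fun a h => hcut a (le_trans (min_le_left _ _) h)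
  have key : ∀ (c : ℝ) (a : ℝ) (d : ℝ), c * g a * Yu a * d = c * g a * Y a * d := by
    intro c a d
    by_cases h : a < η₁
    · rw [heq a h]
    · rw [hcut a (le_trans (min_le_right _ _) (not_lt.1 h))]
      simp
  have H' := H σ hσ hσ' Φ τ hτ χ hχ g hg hcut'
  simp only [key] at H'
  exact H'

/-- **Pinning lemma, positive-argument form (statement).** Agreement of `Yu` with `Y` on `(0, η₁)` already
suffices: the argument `σ³ρ_r` is `≥ 0`, and where it vanishes the pair functional `B_r` vanishes too
(`bx ≥ 0` continuous with zero `μ`-integral ⇒ `bx = 0` `μ`-a.e. ⇒ `B_r = 0`), so the junk values `Yu 0`,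
`Y 0 = (3/2π)·(deriv f_ex) 0 = 0` never enter — this is exactly the disprover's landed
`pairFunctional_eq_zero_of_mollifiedDensity_eq_zero` / `Bfun_eq_zero_of_rhoM_eq_zero` (Disproof.lean §4,
Theorems/EvenStressEnskog/Negative/PairFunctionalVanishing.lean), with which it is PROVED below (conditional
rewrite specialised to the crux's marks `Ξ_P^{kl}`). -/
theorem evenStressWith_congr_pos {Yu Y : ℝ → ℝ} {η₀ η₁ : ℝ} (hU : EvenStressWith Yu η₀)
    (heq : ∀ a, 0 < a → a < η₁ → Yu a = Y a) : EvenStressWith Y (min η₀ η₁) := by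
  intro a₀ θ₀ u₀ ha hθ hu ha0 hθ0
  obtain ⟨σ₀, hσ₀, H⟩ := hU a₀ θ₀ u₀ ha hθ hu ha0 hθ0
  refine ⟨σ₀, hσ₀, ?_⟩
  intro σ hσ hσ' Φ τ hτ χ hχ g hg hcut η δ hη hδ
  have hcut' : ∀ a, η₀ ≤ a → g a = 0 := fun a h => hcut a (le_trans (min_le_left _ _) h)
  obtain ⟨r₀, hr₀, H2⟩ := H σ hσ hσ' Φ τ hτ χ hχ g hg hcut' η δ hη hδ
  refine ⟨r₀, hr₀, ?_⟩
  intro r hr hrr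
  obtain ⟨N₀, H3⟩ := H2 r hr hrr
  refine ⟨N₀, fun N hN => ?_⟩
  have H4 := H3 N hN
  -- the conditional rewrite: on every configuration, either `ρ_r(x₀) = 0` (then `B_r = 0`, disprover's §4
  -- lemma) or `σ³ρ_r(x₀) > 0`, where `g·Yu = g·Y` by `heq` below `η₁` and by the cutoff above it.
  have key : ∀ (k l : Fin 3) (w : Config (N + 1) (Fin 3) T3) (x₀ : T3) (c : ℝ),
      c * g (σ ^ 3 * ∫ q, 3 / (Real.pi * r ^ 3) * max (1 - Torus.euclidDist q.1 x₀ / r) 0 ∂(empiricalMeasure w)) *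
        Yu (σ ^ 3 * ∫ q, 3 / (Real.pi * r ^ 3) * max (1 - Torus.euclidDist q.1 x₀ / r) 0 ∂(empiricalMeasure w)) *
        (∫ p, 3 / (Real.pi * r ^ 3) * max (1 - Torus.euclidDist p.1.1 x₀ / r) 0 *
            (3 / (Real.pi * r ^ 3) * max (1 - Torus.euclidDist p.2.1 x₀ / r) 0) *
            ∫ ω : Metric.sphere (0 : V3) 1,
              max ⟪p.2.2 - p.1.2, (ω : V3)⟫_ℝ 0 * ((ω : V3) k * (ω : V3) l) * hardSphereKernel (p.2.2, p.1.2) ω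
              ∂sphereMeasure ∂((empiricalMeasure w).prod (empiricalMeasure w)))
      = c * g (σ ^ 3 * ∫ q, 3 / (Real.pi * r ^ 3) * max (1 - Torus.euclidDist q.1 x₀ / r) 0 ∂(empiricalMeasure w)) *
        Y (σ ^ 3 * ∫ q, 3 / (Real.pi * r ^ 3) * max (1 - Torus.euclidDist q.1 x₀ / r) 0 ∂(empiricalMeasure w)) *
        (∫ p, 3 / (Real.pi * r ^ 3) * max (1 - Torus.euclidDist p.1.1 x₀ / r) 0 *
            (3 / (Real.pi * r ^ 3) * max (1 - Torus.euclidDist p.2.1 x₀ / r) 0) *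
            ∫ ω : Metric.sphere (0 : V3) 1,
              max ⟪p.2.2 - p.1.2, (ω : V3)⟫_ℝ 0 * ((ω : V3) k * (ω : V3) l) * hardSphereKernel (p.2.2, p.1.2) ω
              ∂sphereMeasure ∂((empiricalMeasure w).prod (empiricalMeasure w))) := by
    intro k l w x₀ c
    by_cases hρ : (∫ q, 3 / (Real.pi * r ^ 3) * max (1 - Torus.euclidDist q.1 x₀ / r) 0 ∂(empiricalMeasure w)) = 0
    · have h0 := Summit.AtomisticToContinuum.HydrodynamicLimit.Theorems.EvenStressEnskog.pairFunctional_eq_zero_of_mollifiedDensity_eq_zero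
        hr (fun q : V3 × V3 × V3 => max ⟪q.2.2 - q.2.1, q.1⟫_ℝ 0 * (q.1 k * q.1 l)) w x₀ hρ
      simp only at h0
      rw [h0]
      simp
    · have hnn : 0 ≤ ∫ q, 3 / (Real.pi * r ^ 3) * max (1 - Torus.euclidDist q.1 x₀ / r) 0 ∂(empiricalMeasure w) :=
        integral_nonneg fun q =>
          Summit.AtomisticToContinuum.HydrodynamicLimit.Theorems.EvenStressEnskog.coneMollifier_nonneg hr q.1 x₀
      have hpos : 0 < σ ^ 3 * ∫ q, 3 / (Real.pi * r ^ 3) * max (1 - Torus.euclidDist q.1 x₀ / r) 0 ∂(empiricalMeasure w) :=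
        mul_pos (pow_pos hσ 3) (lt_of_le_of_ne hnn (Ne.symm hρ))
      by_cases h1 : σ ^ 3 * ∫ q, 3 / (Real.pi * r ^ 3) * max (1 - Torus.euclidDist q.1 x₀ / r) 0 ∂(empiricalMeasure w) < η₁
      · rw [heq _ hpos h1]
      · rw [hcut _ (le_trans (min_le_right _ _) (not_lt.1 h1))]
        simp
  simp only [key] at H4
  exact H4

/-- **Rung-0 static input (R0c).** Derivatives of the finite-`N` canonical free energies
`F_N(η) = -N⁻¹ log hsFreeVolume η N` converge to `f_ex′(η)` at small density (canonical cluster expansion: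
Pulvirenti–Tsagkarogiannis, CMP 316 (2012) doi:10.1007/s00220-012-1576-y; JSP 159 (2015)
doi:10.1007/s10955-015-1207-z). With the EXACT finite-`N` identity
`-N⁻¹ ∂_η log hsFreeVolume η N = (2π/3)(1 - 1/N)·Y_N(η)` (coarea formula on `{min dist = ε}`,
`η = Nε³`; `Y_N` = canonical contact value on `𝕋³`) this is `Y_N(η) → thermoContact η`. -/
def CanonicalContactConvergence (η₀ : ℝ) : Prop :=
  ∀ η ∈ Set.Ioo 0 η₀, Tendsto (fun N : ℕ => -(N : ℝ)⁻¹ * deriv (fun a => Real.log (hsFreeVolume a N)) η)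
    atTop (𝓝 (deriv hsExcessFreeEnergy η))

/-- **Rung 0 evaluates every universal law (statement of the identification step).** If the contact
statistics are universal with law `Yu` below `η₀`, then `Yu = thermoContact` on `(0, η₁)` for some
`η₁ > 0`: test (U) on CONSTANT profiles (`a₀ ≡ 1`, `u₀ ≡ 0`, `θ₀ ≡ 1`, `σ³ = η*`), where the local Gibbs law
is the flow-invariant canonical Gibbs law, the statistic concentrates at `τ·σ³·Y_N(σ³)·(ideal pair rate)`
(exact mean by stationarity + coarea/Palm; variance by the pre-collision-tube U-statistic and static
clustering), and `Y_N → thermoContact` (`CanonicalContactConvergence`). -/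
def Rung0Identifies : Prop :=
  ∀ (Yu : ℝ → ℝ) (η₀ : ℝ), 0 < η₀ → ContinuousOn Yu (Ioo 0 η₀) → EvenStressWith Yu η₀ →
    ∃ η₁ : ℝ, 0 < η₁ ∧ ∀ a, 0 < a → a < η₁ → Yu a = thermoContact a

/-- **Card B assembly (proved from the two lemmas above):** universality + rung-0 identification ⇒ crux. -/
theorem evenStressEnskog_of_universal (hU : UniversalEvenContactLaw) (hR : Rung0Identifies) :
    EvenStressEnskog := by
  obtain ⟨η₀, hη₀, Yu, hcont, hES⟩ := hU
  obtain ⟨η₁, hη₁, heq⟩ := hR Yu η₀ hη₀ hcont hES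
  exact evenStressEnskog_iff.2 ⟨min η₀ η₁, lt_min hη₀ hη₁, evenStressWith_congr_pos hES heq⟩

/-! ## Card A — defect-hierarchy-zero-driving -/

/-- The elastic collision law commutes with a common translation of both velocities. [folklore] -/
theorem collide_sub_sub (ω : sphere (0 : V3) 1) (u v w : V3) :
    collide ω (v - u, w - u) = ((collide ω (v, w)).1 - u, (collide ω (v, w)).2 - u) := by
  have h : v - u - (w - u) = v - w := by abel
  simp only [collide, h, Prod.mk.injEq]
  constructor <;> abel

/-- **Maxwellian pair weights are collision invariants**: `M(v′)M(w′) = M(v)M(w)` for the local Maxwellian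
with any bulk velocity `u` and temperature `θ` (energy conservation in the frame of `u`). This is the
pointwise detailed balance of the EQUILIBRIUM contact law that kills every `eq`-coefficient source in the
defect hierarchy. -/
theorem localMaxwellian_collide_mul (θ : ℝ) (u : V3) (ω : sphere (0 : V3) 1) (v w : V3) :
    localMaxwellian 1 θ u (collide ω (v, w)).1 * localMaxwellian 1 θ u (collide ω (v, w)).2 =
      localMaxwellian 1 θ u v * localMaxwellian 1 θ u w := by
  have key : ‖(collide ω (v, w)).1 - u‖ ^ 2 + ‖(collide ω (v, w)).2 - u‖ ^ 2 =
      ‖v - u‖ ^ 2 + ‖w - u‖ ^ 2 := by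
    have h := norm_sq_collide_fst_add_norm_sq_collide_snd ω (v - u, w - u)
    rw [collide_sub_sub] at h
    simpa using h
  simp only [localMaxwellian, one_mul]
  set c : ℝ := (2 * π * θ) ^ (-(Module.finrank ℝ V3 : ℝ) / 2) with hc
  have e1 : c * rexp (-‖(collide ω (v, w)).1 - u‖ ^ 2 / (2 * θ)) * (c * rexp (-‖(collide ω (v, w)).2 - u‖ ^ 2 / (2 * θ)))
      = c * c * rexp (-(‖(collide ω (v, w)).1 - u‖ ^ 2 + ‖(collide ω (v, w)).2 - u‖ ^ 2) / (2 * θ)) := by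
    rw [show -(‖(collide ω (v, w)).1 - u‖ ^ 2 + ‖(collide ω (v, w)).2 - u‖ ^ 2) / (2 * θ)
        = -‖(collide ω (v, w)).1 - u‖ ^ 2 / (2 * θ) + -‖(collide ω (v, w)).2 - u‖ ^ 2 / (2 * θ) by ring,
      Real.exp_add]
    ring
  have e2 : c * rexp (-‖v - u‖ ^ 2 / (2 * θ)) * (c * rexp (-‖w - u‖ ^ 2 / (2 * θ)))
      = c * c * rexp (-(‖v - u‖ ^ 2 + ‖w - u‖ ^ 2) / (2 * θ)) := by
    rw [show -(‖v - u‖ ^ 2 + ‖w - u‖ ^ 2) / (2 * θ) = -‖v - u‖ ^ 2 / (2 * θ) + -‖w - u‖ ^ 2 / (2 * θ) by ring,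
      Real.exp_add]
    ring
  rw [e1, e2, key]

/-- **Level-2 structure of the defect hierarchy, pointwise.** For a two-body defect written in slot 1 as
`M(v₁) g(v₁)` (other arguments frozen) and a Maxwellian spectator, the (1,3)-collision integrands of the two
admissible products `δu₂(1,2)·M(3)` ("1 scatters off an uncorrelated 3") and `δu₂(3,2)·M(1)` ("a correlated
3 transfers its correlation to 1") ADD UP to the linearised hard-sphere integrand with weight `M(v₁)M(v₃)`:
the linear part of the defect hierarchy has coefficient `ρM` only — it is state-independent. -/
theorem defect_level2_integrand (θ : ℝ) (u : V3) (g : V3 → ℝ) (ω : sphere (0 : V3) 1) (v w : V3) :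
    hardSphereKernel (v, w) ω *
        (localMaxwellian 1 θ u (collide ω (v, w)).1 * g (collide ω (v, w)).1 * localMaxwellian 1 θ u (collide ω (v, w)).2
          - localMaxwellian 1 θ u v * g v * localMaxwellian 1 θ u w)
      + hardSphereKernel (v, w) ω *
        (localMaxwellian 1 θ u (collide ω (v, w)).1 * localMaxwellian 1 θ u (collide ω (v, w)).2 * g (collide ω (v, w)).2
          - localMaxwellian 1 θ u v * localMaxwellian 1 θ u w * g w)
      = hardSphereKernel (v, w) ω * (localMaxwellian 1 θ u v * localMaxwellian 1 θ u w) *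
        (g (collide ω (v, w)).1 + g (collide ω (v, w)).2 - g v - g w) := by
  have h := localMaxwellian_collide_mul θ u ω v w
  calc _ = hardSphereKernel (v, w) ω *
        ((localMaxwellian 1 θ u (collide ω (v, w)).1 * localMaxwellian 1 θ u (collide ω (v, w)).2) *
            (g (collide ω (v, w)).1 + g (collide ω (v, w)).2)
          - localMaxwellian 1 θ u v * localMaxwellian 1 θ u w * (g v + g w)) := by ring
    _ = _ := by rw [h]; ring

/-- **Level-2 structure, integrated**: the summed (1,3)-collision term equals `M(v₁)·𝓛♭[g](v₁)` with the
tree's `linearizedEnskogOperator` (contact factor `1`, density `1`; the density `ρ` and Enskog's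
delocalisation ride along as scalars/offsets, `linearizedEnskogOperatorDeloc`). No integrability is needed:
the statement is about ONE integral of the summed integrand. -/
theorem defect_level2_collision_term {θ : ℝ} (hθ : 0 < θ) (u : V3) (g : V3 → ℝ) (v : V3) :
    ∫ w, ∫ ω, (hardSphereKernel (v, w) ω *
        (localMaxwellian 1 θ u (collide ω (v, w)).1 * g (collide ω (v, w)).1 * localMaxwellian 1 θ u (collide ω (v, w)).2
          - localMaxwellian 1 θ u v * g v * localMaxwellian 1 θ u w)
      + hardSphereKernel (v, w) ω *
        (localMaxwellian 1 θ u (collide ω (v, w)).1 * localMaxwellian 1 θ u (collide ω (v, w)).2 * g (collide ω (v, w)).2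
          - localMaxwellian 1 θ u v * localMaxwellian 1 θ u w * g w)) ∂sphereMeasure
      = localMaxwellian 1 θ u v * linearizedEnskogOperator 1 1 u θ g v := by
  rw [linearizedEnskogOperator_eq_integral hθ, one_mul, ← integral_const_mul]
  refine integral_congr_ae (Filter.Eventually.of_forall fun w => ?_)
  simp only [defect_level2_integrand]
  rw [mul_comm (∫ ω, _ ∂sphereMeasure) (localMaxwellian 1 θ u w), ← mul_assoc, ← integral_const_mul]
  refine integral_congr_ae (Filter.Eventually.of_forall fun ω => ?_)
  simp only
  ring

/-- **One-body stationarity in weak form** for an incoming contact function `F(n̂, v, w)` (already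
multiplied by nothing: the kernel `((w - v)·n̂)₊` is explicit): every bounded continuous `φ` has zero
collisional rate of change, `∫ ((w-v)·n̂)₊ F (φ(v′) - φ(v)) = 0` (`v′ = (reflectVel n̂ (v,w)).1`). Both the
stationary local limit (with `F = f₂⁻`) and the Gibbs state satisfy it, hence so does their DEFECT. -/
def WeakOneBodyStationary (F : V3 × V3 × V3 → ℝ) : Prop :=
  ∀ φ : V3 → ℝ, Continuous φ → (∃ C, ∀ v, |φ v| ≤ C) →
    ∫ q : (V3 × V3) × sphere (0 : V3) 1,
        hardSphereKernel (q.1.2, q.1.1) q.2 * F ((q.2 : V3), q.1.1, q.1.2) *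
          (φ (reflectVel (q.2 : V3) q.1).1 - φ q.1.1)
      ∂(((volume : Measure V3).prod volume).prod sphereMeasure) = 0

/-- **Spectator-factorised sources vanish (exact cancellation (i) of Card A).** If `F` is weakly one-body
stationary then for every bounded continuous two-argument mark `Φ` and every frozen spectator velocity `u`
the source `∫ ((w-v)·n̂)₊ F (Φ(v′,u) - Φ(v,u)) = 0`: in the defect hierarchy every term in which the new
particle's block is `{i, new}` alone drops out, for BOTH parities. -/
theorem spectator_source_vanishes {F : V3 × V3 × V3 → ℝ} (hF : WeakOneBodyStationary F)
    (Φ : V3 → V3 → ℝ) (hΦ : Continuous (Function.uncurry Φ)) (hb : ∃ C, ∀ v u, |Φ v u| ≤ C) (u : V3) :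
    ∫ q : (V3 × V3) × sphere (0 : V3) 1,
        hardSphereKernel (q.1.2, q.1.1) q.2 * F ((q.2 : V3), q.1.1, q.1.2) *
          (Φ (reflectVel (q.2 : V3) q.1).1 u - Φ q.1.1 u)
      ∂(((volume : Measure V3).prod volume).prod sphereMeasure) = 0 := by
  obtain ⟨C, hC⟩ := hb
  exact hF (fun v => Φ v u) (hΦ.comp (continuous_id.prodMk continuous_const)) ⟨C, fun v => hC v u⟩

/-- **First genuine stub of line A (signature): a Liouville theorem for the stationary linearised PAIR
equation.** `ε = 0` caricature on whole space (the hard-core boundary between particles 1 and 2 and Enskog's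
delocalisation are conservative for the `L²(M⁻¹M⁻¹)` energy and are added in the crux-plan): a `C¹`
two-body defect `G(x₁,x₂)(v₁,v₂) = M(v₁)M(v₂)·h`, decaying at spatial infinity, whose free transport equals
the slotwise linearised collision terms, vanishes identically — energy method: transport is antisymmetric,
`-⟪h, 𝓛♭h⟫ ≥ gap·‖(1-P)h‖²`, and decaying hydrodynamic (Killing-type) modes are zero. Prior art for ONE
particle: Case 1972 doi:10.1063/1.1693919; Garbanati–Greenberg–Zweifel 1978 doi:10.1063/1.523545. -/
def PairLiouville (θ : ℝ) (u : V3) : Prop :=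
  ∀ h : (V3 × V3) → (V3 × V3) → ℝ,
    ContDiff ℝ 1 (Function.uncurry h) →
    (∀ V : V3 × V3, Tendsto (fun X : V3 × V3 => h X V) (cocompact _) (𝓝 0)) →
    (∀ (X V : V3 × V3),
      fderiv ℝ (fun X' : V3 × V3 => h X' V) X (V.1, V.2) =
        linearizedEnskogOperator 1 1 u θ (fun v₁ => h X (v₁, V.2)) V.1 +
          linearizedEnskogOperator 1 1 u θ (fun v₂ => h X (V.1, v₂)) V.2) →
    ∀ X V, h X V = 0

end

end Summit.AtomisticToContinuum.HydrodynamicLimit.Cruxes.EvenStressEnskog.IdeatorTwo
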